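/-
Copyright (c) 2026 the pub-hodgecm-mathlib formalisation cell (harness21).  Prover seat hodgecm-mathlib-K2E3-p26 (g2), Track B «K2-LIT» (valve hand → L1),
#184♮ = hLiu418 = `stmt-HodgeConjecture-24832`; socket #41, KIND 1, organ (K1b-W) (line lead K2Liu-p14 (g4)), brick (KW1-c) — road (R-a) of the SPLIT-PLACE seam
(K2 bus 2026-09-04T23:21:57Z, audited SOUND by K2Liu-audit1 23:2xZ): the two local heights of a UNITARY adelic point at conjugate places agree up to the form's height.
THEOREMS ONLY (no `def`, no `instance`, no notation, no named-fact hypothesis, no `sorry`); lane `--supports stmt-HodgeConjecture-24832` (count-neutral helper; closes no socket by itself).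
-/
import Summits.HodgeConjecture.HodgeConjecture.Theorems.K2LiuLocalHeightLevelConjugation   -- ★ (c1) p862721 (this seat): `nnnorm_apply_le_localHeight`; brings ★ `GLn.localHeight`, `AdelicHeightGLProofs` (`nnnorm_mul_apply_le_of_isUltrametricDist`)
import Literature.NumberTheory.Automorphic.AdelicVectorHeightGalois                        -- ★ `norm_galAdicCompletionMap` (`‖σ y‖_{σ w} = ‖y‖_w`); brings ★ `GaloisActionAdeleRing` (`AdeleRing.smul_snd`, `FiniteAdeleRing.smul_apply_smul`)
import Literature.NumberTheory.Automorphic.UnitaryGroupAutomorphicRep                      -- ★ `unitaryGroupOfForm`, `mem_unitaryGroupOfForm_iff`, `conjAdele` (`conjAdele_apply : conjAdele F E c x = c • x`)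
import HarnessLib

/-!
# Crux `HLiu418`, socket #41, (K1b-W) brick (KW1-c), road (R-a) — `K2LiuLocalHeightConjugatePlace`: FOR A UNITARY ADELIC POINT `g` (`σ(g)ᵀ J g = J`, `σ = c ⊗ 1` AN
# INVOLUTION) THE LOCAL HEIGHTS AT CONJUGATE PLACES AGREE UP TO THE FORM: `H_{c·w}(g) ≤ H_w(J)·H_w(g)·H_w(J)`

Cell `hodgecm-mathlib`, crux item hLiu418 = `stmt-HodgeConjecture-24832` (helper lane `--supports … --as helper`, count-neutral), route of record `HCCMUnconditional`;
squad K2 ∕ K2Liu (L1, LEAD F0P6-plan (g14)), road `K2_Liu`, socket #41, KIND 1, organ (K1b-W) (line lead K2Liu-p14 (g4)), brick (KW1-c) of K2E3-p26 (g2): (c1) ★ p862721 ·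
(c2) ★ p862738 · HEAD ★ p862891 · (c4) ★ p862912 ∕ p862950 ∕ p863010.  THE SEAM this file closes (DESIGN NOTE 2026-09-04T23:21:57Z, audit «(R-a) SOUND»): at a SPLIT place
`v = w·w̄` of `L⁺` the invariance level of the corner translate `y ↦ f(ι y·g_v)` is governed by BOTH local heights `H_w(g)`, `H_w̄(g)` (★ (c1) at `w` and at `w̄ = c·w`), whereas the
lattice letter `hlat` of ★ `hsupp_line_of_latticeLetter` ∕ `hloc` of ★ `hsupp_of_local` may only use `H_w(g)`.  For a UNITARY `g` the two agree up to a constant: the unitarity relation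
`σ(g)ᵀ·J·g = J` gives `σ(g) = (J·g⁻¹·J⁻¹)ᵀ` and `σ(g⁻¹) = (J·g·J⁻¹)ᵀ`, the Galois involution `σ = c ⊗ 1` PERMUTES the places isometrically (`‖y_{c·w}‖ = ‖(c·y)_w‖`,
★ `norm_galAdicCompletionMap`), and entries of a triple product are bounded ultrametrically (★ `nnnorm_mul_apply_le_of_isUltrametricDist`); so
`H_{c·w}(g) ≤ H_w(J)·H_w(g)·H_w(J)`, with `H_w(J) = 1` at every place where the form is unimodular (cofinitely many).
* §1 `nnnorm_snd_smul_smul` (`‖(c·y)_{c·w}‖ = ‖y_w‖`), `nnnorm_snd_smul_place` (`c` an involution: `‖y_{c·w}‖ = ‖(c·y)_w‖`).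
* §2 `nnnorm_snd_triple_mul_apply_le` — entries of `A·B·C` at `w` are `≤ a·b·c′` when those of `A, B, C` are `≤ a, b, c′`.
* §3 `map_conjAdele_eq_of_mem` ∕ `map_conjAdele_inv_eq_of_mem` — the unitarity relation solved for `σ(g)`, `σ(g⁻¹)`; **`localHeight_smul_le_of_mem_unitaryGroupOfForm`** — the bound.
[BorelJacquet1979, §1.2]; [MoeglinWaldspurger1995, I.2.2]; [PlatonovRapinchuk1994, §2.3 (unitary groups), §5.1]; [CasselsFrohlichANT1967, Ch. II §10, Ch. VII §1].

HONEST LABEL.  Count-neutral helper; it retires nothing by itself: `HC_CM` is proved only modulo the 7 printed citations (2 remaining named inputs: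
hLiu418 = `stmt-HodgeConjecture-24832`, h413 = `stmt-HodgeConjecture-24833`) until rung 0 closes.

## References
* [BorelJacquet1979] A. Borel, H. Jacquet, *Automorphic forms and automorphic representations*, Proc. Sympos. Pure Math. 33.1 (1979), §1.2 (the height `‖g‖ = ∏ H_v(g)`).
* [MoeglinWaldspurger1995] C. Mœglin, J.-L. Waldspurger, *Spectral decomposition and Eisenstein series*, Cambridge Tracts 113 (1995), I.2.2.
* [PlatonovRapinchuk1994] V. Platonov, A. Rapinchuk, *Algebraic Groups and Number Theory* (1994), §2.3 (unitary groups of hermitian forms), §5.1 (adelic points).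
* [CasselsFrohlichANT1967] J. W. S. Cassels, A. Fröhlich (eds.), *Algebraic Number Theory* (1967), Ch. II §10, Ch. VII §1 (Galois action on adeles, conjugate places).
-/

set_option autoImplicit false
-- the mandated namespace repeats the single-problem summit's segment (`HodgeConjecture.HodgeConjecture`)
set_option linter.dupNamespace false

noncomputable section

open scoped NNReal MatrixGroups
open NumberField IsDedekindDomain Matrix
open Literature.NumberTheory.Automorphic Literature.NumberTheory.Automorphic.UnitaryGroup

namespace Summit.HodgeConjecture.HodgeConjecture.Cruxes.HLiu418.K2LiuLocalHeightConjugatePlace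

open Summit.HodgeConjecture.HodgeConjecture.Cruxes.HLiu418.K2LiuLocalHeightLevelConjugation (nnnorm_apply_le_localHeight)

variable (F : Type) [Field F] (E : Type) [Field E] [NumberField E] [Algebra F E] (c : E ≃ₐ[F] E)

/-! ## §1 The Galois involution permutes the places isometrically -/

/-- **`‖(c·y)_{c·w}‖ = ‖y_w‖`** for an adele `y` of `E` and an automorphism `c` (★ `FiniteAdeleRing.smul_apply_smul` + ★ `norm_galAdicCompletionMap`).
[cite: CasselsFrohlichANT1967, Ch. VII §1] -/
theorem nnnorm_snd_smul_smul (y : AdeleRing (𝓞 E) E) (w : HeightOneSpectrum (𝓞 E)) : ‖(c • y).2 (c • w)‖₊ = ‖y.2 w‖₊ := by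
  apply NNReal.eq
  rw [coe_nnnorm, coe_nnnorm, AdeleRing.smul_snd, FiniteAdeleRing.smul_apply_smul]
  exact norm_galAdicCompletionMap c _ _

/-- **`‖y_{c·w}‖ = ‖(c·y)_w‖` when `c` is an involution** (`c·c = 1`: §1 applied to the adele `c·y` at the place `w`, using `c·(c·y) = y`).
[cite: CasselsFrohlichANT1967, Ch. VII §1] -/
theorem nnnorm_snd_smul_place (hcc : c * c = 1) (y : AdeleRing (𝓞 E) E) (w : HeightOneSpectrum (𝓞 E)) : ‖y.2 (c • w)‖₊ = ‖(c • y).2 w‖₊ := by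
  have h := nnnorm_snd_smul_smul F E c (c • y) w
  rwa [smul_smul, hcc, one_smul] at h

/-! ## §2 Entries of a triple product at a place (ultrametric) -/

/-- the `w`-component of a matrix entry of a product: `((A·B) i j)_w = Σ_k (A i k)_w (B k j)_w`, i.e. `(A·B)_w = A_w·B_w` entrywise under the ring map `x ↦ x_w`. [folklore] -/
theorem snd_mul_apply {m : Type*} [Fintype m] [DecidableEq m] (A B : Matrix m m (AdeleRing (𝓞 E) E)) (w : HeightOneSpectrum (𝓞 E)) (i j : m) :
    ((A * B) i j).2 w = ((A.map (AdelicGroupData.adeleEval E w)) * (B.map (AdelicGroupData.adeleEval E w))) i j := by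
  rw [← Matrix.map_mul, Matrix.map_apply, AdelicGroupData.adeleEval_apply]

/-- **Entries of `A·B·C` at `w` are `≤ a·b·c′`** when the entries of `A`, `B`, `C` at `w` are `≤ a`, `b`, `c′` (`E_w` is ultrametric; ★ `nnnorm_mul_apply_le_of_isUltrametricDist` twice).
[cite: CasselsFrohlichANT1967, Ch. II §10] -/
theorem nnnorm_snd_triple_mul_apply_le {m : Type*} [Fintype m] [DecidableEq m] (A B C : Matrix m m (AdeleRing (𝓞 E) E)) (w : HeightOneSpectrum (𝓞 E)) {a b c' : ℝ≥0}
    (hA : ∀ i j, ‖(A i j).2 w‖₊ ≤ a) (hB : ∀ i j, ‖(B i j).2 w‖₊ ≤ b) (hC : ∀ i j, ‖(C i j).2 w‖₊ ≤ c') (i j : m) :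
    ‖((A * B * C) i j).2 w‖₊ ≤ a * b * c' := by
  have hA' : ∀ i j, ‖(A.map (AdelicGroupData.adeleEval E w)) i j‖₊ ≤ a := fun i j => by rw [Matrix.map_apply, AdelicGroupData.adeleEval_apply]; exact hA i j
  have hB' : ∀ i j, ‖(B.map (AdelicGroupData.adeleEval E w)) i j‖₊ ≤ b := fun i j => by rw [Matrix.map_apply, AdelicGroupData.adeleEval_apply]; exact hB i j
  have hC' : ∀ i j, ‖(C.map (AdelicGroupData.adeleEval E w)) i j‖₊ ≤ c' := fun i j => by rw [Matrix.map_apply, AdelicGroupData.adeleEval_apply]; exact hC i j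
  rw [snd_mul_apply, Matrix.map_mul]
  exact nnnorm_mul_apply_le_of_isUltrametricDist (nnnorm_mul_apply_le_of_isUltrametricDist hA' hB') hC' i j

/-! ## §3 The unitarity relation and the height bound at the conjugate place -/

section Unitary

variable {m : ℕ}

/-- **The unitarity relation solved for `σ(g)`**: `g ∈ U(σ, J)` (`σ(g)ᵀ·J·g = J`, `J` invertible) ⟹ `σ(g) = (J·g⁻¹·J⁻¹)ᵀ`, `σ = conjAdele = c ⊗ 1`.
[cite: PlatonovRapinchuk1994, §2.3] -/
theorem map_conjAdele_eq_of_mem (Jm : GL (Fin m) (AdeleRing (𝓞 E) E)) {g : GL (Fin m) (AdeleRing (𝓞 E) E)}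
    (hg : g ∈ unitaryGroupOfForm (conjAdele F E c) (Jm : Matrix (Fin m) (Fin m) (AdeleRing (𝓞 E) E))) :
    (g : Matrix (Fin m) (Fin m) (AdeleRing (𝓞 E) E)).map (conjAdele F E c) =
      ((Jm : Matrix (Fin m) (Fin m) (AdeleRing (𝓞 E) E)) * ((g⁻¹ : GL (Fin m) (AdeleRing (𝓞 E) E)) : Matrix (Fin m) (Fin m) (AdeleRing (𝓞 E) E)) *
        ((Jm⁻¹ : GL (Fin m) (AdeleRing (𝓞 E) E)) : Matrix (Fin m) (Fin m) (AdeleRing (𝓞 E) E)))ᵀ := by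
  have hrel := (mem_unitaryGroupOfForm_iff.1 hg)
  -- `σ(g)ᵀ = σ(g)ᵀ·J·g·(g⁻¹·J⁻¹) = J·g⁻¹·J⁻¹`
  have ht : ((g : Matrix (Fin m) (Fin m) (AdeleRing (𝓞 E) E)).map (conjAdele F E c))ᵀ =
      (Jm : Matrix (Fin m) (Fin m) (AdeleRing (𝓞 E) E)) * ((g⁻¹ : GL (Fin m) (AdeleRing (𝓞 E) E)) : Matrix (Fin m) (Fin m) (AdeleRing (𝓞 E) E)) *
        ((Jm⁻¹ : GL (Fin m) (AdeleRing (𝓞 E) E)) : Matrix (Fin m) (Fin m) (AdeleRing (𝓞 E) E)) := by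
    calc ((g : Matrix (Fin m) (Fin m) (AdeleRing (𝓞 E) E)).map (conjAdele F E c))ᵀ
        = ((g : Matrix (Fin m) (Fin m) (AdeleRing (𝓞 E) E)).map (conjAdele F E c))ᵀ * (Jm : Matrix (Fin m) (Fin m) (AdeleRing (𝓞 E) E)) *
            (g : Matrix (Fin m) (Fin m) (AdeleRing (𝓞 E) E)) *
            (((g⁻¹ : GL (Fin m) (AdeleRing (𝓞 E) E)) : Matrix (Fin m) (Fin m) (AdeleRing (𝓞 E) E)) *
              ((Jm⁻¹ : GL (Fin m) (AdeleRing (𝓞 E) E)) : Matrix (Fin m) (Fin m) (AdeleRing (𝓞 E) E))) := by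
          rw [Matrix.mul_assoc, Matrix.mul_assoc, ← Matrix.mul_assoc (g : Matrix (Fin m) (Fin m) (AdeleRing (𝓞 E) E)), ← Units.val_mul, mul_inv_cancel,
            Units.val_one, Matrix.one_mul, ← Units.val_mul, mul_inv_cancel, Units.val_one, Matrix.mul_one]
      _ = _ := by rw [hrel, ← Matrix.mul_assoc]
  rw [← ht, Matrix.transpose_transpose]

/-- **… and for `σ(g⁻¹)`**: `σ(g⁻¹) = (J·g·J⁻¹)ᵀ` (`g⁻¹ ∈ U(σ, J)` too). [cite: PlatonovRapinchuk1994, §2.3] -/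
theorem map_conjAdele_inv_eq_of_mem (Jm : GL (Fin m) (AdeleRing (𝓞 E) E)) {g : GL (Fin m) (AdeleRing (𝓞 E) E)}
    (hg : g ∈ unitaryGroupOfForm (conjAdele F E c) (Jm : Matrix (Fin m) (Fin m) (AdeleRing (𝓞 E) E))) :
    (((g⁻¹ : GL (Fin m) (AdeleRing (𝓞 E) E)) : Matrix (Fin m) (Fin m) (AdeleRing (𝓞 E) E))).map (conjAdele F E c) =
      ((Jm : Matrix (Fin m) (Fin m) (AdeleRing (𝓞 E) E)) * (g : Matrix (Fin m) (Fin m) (AdeleRing (𝓞 E) E)) *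
        ((Jm⁻¹ : GL (Fin m) (AdeleRing (𝓞 E) E)) : Matrix (Fin m) (Fin m) (AdeleRing (𝓞 E) E)))ᵀ := by
  have h := map_conjAdele_eq_of_mem F E c Jm (Subgroup.inv_mem _ hg)
  rwa [inv_inv] at h

/-- **THE TWO LOCAL HEIGHTS OF A UNITARY ADELIC POINT AT CONJUGATE PLACES AGREE UP TO THE FORM**: for `c` an involution (`c·c = 1`, e.g. the complex conjugation of a CM field),
`J ∈ GL_m(𝔸_E)` and `g ∈ U(c ⊗ 1, J)(𝔸)`: **`H_{c·w}(g) ≤ H_w(J)·H_w(g)·H_w(J)`** (`H` = ★ `GLn.localHeight`: max of the norms of the entries of `g_w` and `g_w⁻¹`).  Entry `(i,j)` of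
`g` at `c·w` has norm `‖(c·g_{ij})_w‖ = ‖σ(g)_{ij,w}‖` (§1) and `σ(g) = (J g⁻¹ J⁻¹)ᵀ` (§3); likewise `σ(g⁻¹) = (J g J⁻¹)ᵀ`; each is a triple product with entries bounded by
`H_w(J)·H_w(g)·H_w(J)` (§2, ★ (c1) `nnnorm_apply_le_localHeight`).  With `H_w(J) = 1` where `J` is `w`-unimodular this is `H_w̄(g) ≤ H_w(g)` off the form's bad set — the
split-place seam of the (KW1-c) lattice letter (`max(a_w, a_w̄) ≤ a_w + 2·ord H_w(J)`). [cite: BorelJacquet1979, §1.2] [cite: PlatonovRapinchuk1994, §2.3, §5.1]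
[cite: CasselsFrohlichANT1967, Ch. VII §1] -/
theorem localHeight_smul_le_of_mem_unitaryGroupOfForm (hcc : c * c = 1) (Jm : GL (Fin m) (AdeleRing (𝓞 E) E)) {g : GL (Fin m) (AdeleRing (𝓞 E) E)}
    (hg : g ∈ unitaryGroupOfForm (conjAdele F E c) (Jm : Matrix (Fin m) (Fin m) (AdeleRing (𝓞 E) E))) (w : HeightOneSpectrum (𝓞 E)) :
    GLn.localHeight m E (c • w) g ≤ GLn.localHeight m E w Jm * GLn.localHeight m E w g * GLn.localHeight m E w Jm := by
  -- entry bounds at `w` for `J`, `g`, `g⁻¹`, `J⁻¹`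
  have hJ : ∀ i j, ‖((Jm : Matrix (Fin m) (Fin m) (AdeleRing (𝓞 E) E)) i j).2 w‖₊ ≤ GLn.localHeight m E w Jm := fun i j => by
    have h := (nnnorm_apply_le_localHeight E w Jm i j).1
    rwa [Matrix.GeneralLinearGroup.map_apply, AdelicGroupData.adeleEval_apply] at h
  have hJ' : ∀ i j, ‖(((Jm⁻¹ : GL (Fin m) (AdeleRing (𝓞 E) E)) : Matrix (Fin m) (Fin m) (AdeleRing (𝓞 E) E)) i j).2 w‖₊ ≤ GLn.localHeight m E w Jm := fun i j => by
    have h := (nnnorm_apply_le_localHeight E w Jm i j).2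
    rwa [← map_inv, Matrix.GeneralLinearGroup.map_apply, AdelicGroupData.adeleEval_apply] at h
  have hgw : ∀ i j, ‖((g : Matrix (Fin m) (Fin m) (AdeleRing (𝓞 E) E)) i j).2 w‖₊ ≤ GLn.localHeight m E w g := fun i j => by
    have h := (nnnorm_apply_le_localHeight E w g i j).1
    rwa [Matrix.GeneralLinearGroup.map_apply, AdelicGroupData.adeleEval_apply] at h
  have hgw' : ∀ i j, ‖(((g⁻¹ : GL (Fin m) (AdeleRing (𝓞 E) E)) : Matrix (Fin m) (Fin m) (AdeleRing (𝓞 E) E)) i j).2 w‖₊ ≤ GLn.localHeight m E w g := fun i j => by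
    have h := (nnnorm_apply_le_localHeight E w g i j).2
    rwa [← map_inv, Matrix.GeneralLinearGroup.map_apply, AdelicGroupData.adeleEval_apply] at h
  -- the relation, entrywise, read at `w` through the involution
  have hσ := map_conjAdele_eq_of_mem F E c Jm hg
  have hσ' := map_conjAdele_inv_eq_of_mem F E c Jm hg
  unfold GLn.localHeight
  refine Finset.sup_le fun ij _ => sup_le ?_ ?_
  · rw [Matrix.GeneralLinearGroup.map_apply, AdelicGroupData.adeleEval_apply, nnnorm_snd_smul_place F E c hcc, ← conjAdele_apply F E c,
      ← Matrix.map_apply (f := conjAdele F E c), hσ, Matrix.transpose_apply]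
    exact nnnorm_snd_triple_mul_apply_le E _ _ _ w hJ hgw' hJ' ij.2 ij.1
  · rw [← map_inv, Matrix.GeneralLinearGroup.map_apply, AdelicGroupData.adeleEval_apply, nnnorm_snd_smul_place F E c hcc, ← conjAdele_apply F E c,
      ← Matrix.map_apply (f := conjAdele F E c), hσ', Matrix.transpose_apply]
    exact nnnorm_snd_triple_mul_apply_le E _ _ _ w hJ hgw hJ' ij.2 ij.1

/-- **COROLLARY (unimodular form)**: if `H_w(J) ≤ 1` then `H_{c·w}(g) ≤ H_w(g)` for every `g ∈ U(c ⊗ 1, J)(𝔸)` — the two places over a split `v` carry the same height, so the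
lattice letter at `w` may be paid with `H_w` alone. [cite: BorelJacquet1979, §1.2] [cite: PlatonovRapinchuk1994, §5.1] -/
theorem localHeight_smul_le_of_localHeight_form_le_one (hcc : c * c = 1) (Jm : GL (Fin m) (AdeleRing (𝓞 E) E)) {g : GL (Fin m) (AdeleRing (𝓞 E) E)}
    (hg : g ∈ unitaryGroupOfForm (conjAdele F E c) (Jm : Matrix (Fin m) (Fin m) (AdeleRing (𝓞 E) E))) (w : HeightOneSpectrum (𝓞 E))
    (hJw : GLn.localHeight m E w Jm ≤ 1) : GLn.localHeight m E (c • w) g ≤ GLn.localHeight m E w g := by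
  refine (localHeight_smul_le_of_mem_unitaryGroupOfForm F E c hcc Jm hg w).trans ?_
  calc GLn.localHeight m E w Jm * GLn.localHeight m E w g * GLn.localHeight m E w Jm
      ≤ 1 * GLn.localHeight m E w g * 1 := mul_le_mul' (mul_le_mul' hJw le_rfl) hJw
    _ = GLn.localHeight m E w g := by rw [one_mul, mul_one]

end Unitary

end Summit.HodgeConjecture.HodgeConjecture.Cruxes.HLiu418.K2LiuLocalHeightConjugatePlace

end
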